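import Summits.CriticalPhenomena.PercolationContinuityZ3.Theorems.PercNearOneGluingNoHeavyLowerTailThreePartitionVOrderUnitMatching

/-!
# Conjecture V (untwisted) from a unit matching on `Finset` faces (support file)

Support file (prover seat `prim-bnk-2`, gen 31; `--supports stmt-CriticalPhenomena-4575`).  Proof document:
`run/shared/lean/prim/prim-l12/prim-bnk-2/PROOF-THEOREM-I1.md`.

`vSumT_nonneg_of_unitMatching` (file `…VOrderUnitMatching`) reduces `vSumT τ 𝒱 𝒲 𝒳 ≥ 0` to an injective, copy-order-increasing map of
the typed negative units into the positive units, in the `Set ι` language of Conjecture V.  The combinatorial data of SCHEME Σ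
(LEMMA I**, LEMMA J**, Kleitman–Hall; `SahiFComb.Shift` toolkit) live on `Finset (Finset ι)`.  This file is the bridge for the untwisted
case `τ = ∅` (the case of THEOREM I₁): with `B = {s : ↑s ∈ 𝒱}`, `C = {s : ↑s ∈ 𝒲}` as predicates on finsets, the unit sets become
`negUnitSetF B C`, `posUnitSetF B C` on `(Finset ι × Finset ι) × ℕ` (faces `(x, y)`, third part `(x ∪ y)ᶜ`, types `0,1,2 = T1,T2,T3`),
and **`vSumT_empty_nonneg_of_unitMatchingF`**: an injection `φ` of `negUnitSetF` into `posUnitSetF` with `x ⊆ x'`, `y ⊆ y'` gives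
`vSumT ∅ 𝒱 𝒲 𝒳 ≥ 0` for every up-set `𝒳`.  Two plumbing definitions; no `sorry`; standard axioms.
-/

noncomputable section

open Finset
open scoped symmDiff Classical

namespace Summit.CriticalPhenomena.PercolationContinuityZ3.Theorems.ThreePartition

variable {ι : Type*} [Fintype ι]

/-- Untwisted typed negative units on finset faces `(x, y)` (`z = (x ∪ y)ᶜ`): `t = 0`: `T1⁻ = [x∈C∖B][z∈B]`, `t = 1`: `T2⁻ = [x∈B∖C][z∈C]`,
`t = 2`: `T3⁻ = [z∈B∩C][y∉C]`. [this work] -/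
def negUnitSetF (B C : Finset (Finset ι)) : Set ((Finset ι × Finset ι) × ℕ) :=
  {u | Disjoint u.1.1 u.1.2 ∧
    ((u.2 = 0 ∧ (u.1.1 ∈ C ∧ u.1.1 ∉ B) ∧ (u.1.1 ∪ u.1.2)ᶜ ∈ B) ∨
      (u.2 = 1 ∧ (u.1.1 ∈ B ∧ u.1.1 ∉ C) ∧ (u.1.1 ∪ u.1.2)ᶜ ∈ C) ∨
      (u.2 = 2 ∧ ((u.1.1 ∪ u.1.2)ᶜ ∈ B ∧ (u.1.1 ∪ u.1.2)ᶜ ∈ C) ∧ u.1.2 ∉ C))}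

/-- Untwisted typed positive units on finset faces: `t = 0`: `T1⁺ = [x∈B∩C][z∉B]`, `t = 1`: `T2⁺ = [x∈B∩C][z∉C]`,
`t = 2`: `T3⁺ = [z∈B∖C][y∈C]`. [this work] -/
def posUnitSetF (B C : Finset (Finset ι)) : Set ((Finset ι × Finset ι) × ℕ) :=
  {u | Disjoint u.1.1 u.1.2 ∧
    ((u.2 = 0 ∧ (u.1.1 ∈ B ∧ u.1.1 ∈ C) ∧ (u.1.1 ∪ u.1.2)ᶜ ∉ B) ∨
      (u.2 = 1 ∧ (u.1.1 ∈ B ∧ u.1.1 ∈ C) ∧ (u.1.1 ∪ u.1.2)ᶜ ∉ C) ∨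
      (u.2 = 2 ∧ ((u.1.1 ∪ u.1.2)ᶜ ∈ B ∧ (u.1.1 ∪ u.1.2)ᶜ ∉ C) ∧ u.1.2 ∈ C))}

/-- **Conjecture V (untwisted) from a unit matching on finset faces.**  Let `𝒱, 𝒲` be families of sets, `B, C` the corresponding families
of finsets (`s ∈ B ↔ ↑s ∈ 𝒱`, `s ∈ C ↔ ↑s ∈ 𝒲`).  If `φ` maps `negUnitSetF B C` injectively into `posUnitSetF B C` with `x ⊆ x'` and
`y ⊆ y'`, then `vSumT ∅ 𝒱 𝒲 𝒳 ≥ 0` for every up-set `𝒳` of the copy order. [this work] -/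
theorem vSumT_empty_nonneg_of_unitMatchingF (𝒱 𝒲 : Set (Set ι)) (B C : Finset (Finset ι))
    (hB : ∀ s : Finset ι, s ∈ B ↔ (s : Set ι) ∈ 𝒱) (hC : ∀ s : Finset ι, s ∈ C ↔ (s : Set ι) ∈ 𝒲)
    (φ : (Finset ι × Finset ι) × ℕ → (Finset ι × Finset ι) × ℕ)
    (hφ : ∀ u ∈ negUnitSetF B C, φ u ∈ posUnitSetF B C ∧ u.1.1 ⊆ (φ u).1.1 ∧ u.1.2 ⊆ (φ u).1.2)
    (hinj : Set.InjOn φ (negUnitSetF B C))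
    (𝒳 : Set (Set ι × Set ι)) (h𝒳 : IsUpperSet 𝒳) : 0 ≤ vSumT ∅ 𝒱 𝒲 𝒳 := by
  classical
  let e : Set ι ≃ Finset ι := Fintype.finsetEquivSet.symm
  have he : ∀ s : Set ι, ((e s : Finset ι) : Set ι) = s := fun s => Fintype.finsetEquivSet.apply_symm_apply s
  -- dictionary between the `Set` units (twist `∅`) and the `Finset` units
  have hmemB : ∀ s : Set ι, e s ∈ B ↔ s ∈ 𝒱 := fun s => by rw [hB, he]
  have hmemC : ∀ s : Set ι, e s ∈ C ↔ s ∈ 𝒲 := fun s => by rw [hC, he]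
  have hcomplB : ∀ s t : Set ι, (e s ∪ e t)ᶜ ∈ B ↔ (s ∪ t)ᶜ ∈ 𝒱 := fun s t => by
    rw [hB, coe_compl, coe_union, he, he]
  have hcomplC : ∀ s t : Set ι, (e s ∪ e t)ᶜ ∈ C ↔ (s ∪ t)ᶜ ∈ 𝒲 := fun s t => by
    rw [hC, coe_compl, coe_union, he, he]
  have hdisj : ∀ s t : Set ι, Disjoint (e s) (e t) ↔ Disjoint s t := fun s t => by
    rw [← disjoint_coe, he, he]
  have hsd : ∀ s : Set ι, s ∆ (∅ : Set ι) = s := fun s => by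
    rw [← Set.bot_eq_empty]; exact symmDiff_bot s
  let toF : (Set ι × Set ι) × ℕ → (Finset ι × Finset ι) × ℕ := fun u => ((e u.1.1, e u.1.2), u.2)
  let toS : (Finset ι × Finset ι) × ℕ → (Set ι × Set ι) × ℕ := fun v => (((v.1.1 : Set ι), (v.1.2 : Set ι)), v.2)
  have hneg : ∀ u, u ∈ negUnitSet (∅ : Set ι) 𝒱 𝒲 ↔ toF u ∈ negUnitSetF B C := by
    intro u
    simp only [negUnitSet, negUnitSetF, Set.mem_setOf_eq, toF, hdisj, hmemB, hmemC, hcomplB, hcomplC, hsd]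
  have hpos : ∀ v, v ∈ posUnitSetF B C ↔ toS v ∈ posUnitSet (∅ : Set ι) 𝒱 𝒲 := by
    intro v
    simp only [posUnitSet, posUnitSetF, Set.mem_setOf_eq, toS, hsd, disjoint_coe, ← coe_union, ← coe_compl, ← hB, ← hC]
  refine vSumT_nonneg_of_unitMatching ∅ 𝒱 𝒲 (fun u => toS (φ (toF u))) (fun u hu => ?_) (fun u hu u' hu' h => ?_) 𝒳 h𝒳
  · obtain ⟨hp, h1, h2⟩ := hφ (toF u) ((hneg u).1 hu)
    have h1' : ((e u.1.1 : Finset ι) : Set ι) ⊆ ((φ (toF u)).1.1 : Set ι) := coe_subset.2 h1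
    have h2' : ((e u.1.2 : Finset ι) : Set ι) ⊆ ((φ (toF u)).1.2 : Set ι) := coe_subset.2 h2
    rw [he] at h1' h2'
    refine ⟨(hpos _).1 hp, ?_, ?_⟩
    · show u.1.1 ∆ ∅ ⊆ ((φ (toF u)).1.1 : Set ι) ∆ ∅
      rw [hsd, hsd]; exact h1'
    · show u.1.2 ∆ ∅ ⊆ ((φ (toF u)).1.2 : Set ι) ∆ ∅
      rw [hsd, hsd]; exact h2'
  · have hinjS : Function.Injective toS := by
      intro v v' hv
      simp only [toS, Prod.mk.injEq, coe_inj] at hv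
      exact Prod.ext (Prod.ext hv.1.1 hv.1.2) hv.2
    have h3 : φ (toF u) = φ (toF u') := hinjS h
    have h4 : toF u = toF u' := hinj ((hneg u).1 hu) ((hneg u').1 hu') h3
    simp only [toF, Prod.mk.injEq] at h4
    refine Prod.ext (Prod.ext ?_ ?_) h4.2
    · rw [← he u.1.1, ← he u'.1.1, h4.1.1]
    · rw [← he u.1.2, ← he u'.1.2, h4.1.2]

end Summit.CriticalPhenomena.PercolationContinuityZ3.Theorems.ThreePartition

end
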